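import Summits.AtomisticToContinuum.Crystallization.Theorems.ChartedZeroExcessLayeredLatticeLiouvilleUW

/-!
# Zero-excess layered lattice Liouville — part UX (lens-2 g57, annex to node «TailCert»): the SB-glue with (T), (HC), (PT), (I1) DISCHARGED.

Bookkeeping only (modus ponens over parts UP, UR, US, UU, UW): [SBᵇ] `SubWindowBudgetBPG ϑ aHi Λ θ s` and [CC°_Ψᵇ] now follow from the two typed glues
(`SubWindowBudgetGlueBPG`, `CaccioppoliGlueBPG`, part UR / UN) and the REMAINING open leaves only:
(LD) `LinearExcessDecayZ` · (RC) `EquilChartStrainP s' Λ' ν'` · (I4ˢ) `TailFluxBSP aHi Λ' θ s'` · hU `UniformTameStabilityE s Λ ν` · hN `EnergyNearChartPX aHi Λ θ s ν`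
(+ [KS] for [CC°_Ψᵇ]) — the struck pieces being (I1) `pairForceTaylorP_holds` (UP), (PT) `linearisationDefectP_holds` (US), (HC) `harmonicComparisonZ_holds` (UU),
(T) `tailDominationCert_holds` (UW).  The record example re-runs the docket of record `strainNonConcentrationBPG_1_50_of_docketPsi` (part UN) at column
`_16XH19B`'s literals with three hypotheses fewer than part UR's.  No statement is re-typed.
-/

noncomputable section

open scoped BigOperators InnerProductSpace RealInnerProductSpace
open MeasureTheory Set Metric Filter Topology
open Summit.AtomisticToContinuum.Crystallization.Theorems.ChartedPlanarOrderRigidityDoor (E3 IsNash atomsIn)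
open Summit.AtomisticToContinuum.Crystallization.Theorems.ChartedPlanarOrderDensityDichotomy (μS IsSep nK nK_nonneg)
open Summit.AtomisticToContinuum.Crystallization.Theorems.ChartedPlanarOrderDoorLayered (Layered layeredHom_eq_layered)
open Literature.Analysis.PDE (ZatorskaGoldstein2005_localGehringLemmaCounting)

namespace Summit.AtomisticToContinuum.Crystallization.Theorems.ChartedZeroExcessLayeredLatticeLiouville

/-- ★ [SBᵇ] from the SB-glue and its OPEN leaves (LD), (RC), (I4ˢ), hU, hN — (T), (HC), (PT), (I1) discharged by the theorems of parts UW, UU, US, UP. [this file, g57] -/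
theorem subWindowBudgetBPG_of_open_pieces {ϑ aHi Λ Λ' θ s s' ν ν' : ℝ} (hglue : SubWindowBudgetGlueBPG ϑ aHi Λ Λ' θ s s' ν ν')
    (hLD : LinearExcessDecayZ) (hRC : EquilChartStrainP s' Λ' ν') (h4 : TailFluxBSP aHi Λ' θ s')
    (hU : UniformTameStabilityE s Λ ν) (hN : EnergyNearChartPX aHi Λ θ s ν) : SubWindowBudgetBPG ϑ aHi Λ θ s :=
  subWindowBudgetBPG_of_pieces hglue tailDominationCert_holds hLD harmonicComparisonZ_holds linearisationDefectP_holds hRC h4 hU hN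

/-- ★★ [CC°_Ψᵇ] from the two glues and the OPEN leaves (LD), (RC), (I4ˢ), hU, hN, [KS]. [this file, g57] -/
theorem coherentGscCaccioppoliPsiBPG_of_open_pieces {ϑ aHi Λ Λ' θ s s' ν ν' : ℝ} (hs : s ≤ s') (hΛ : Λ ≤ Λ')
    (hglueC : CaccioppoliGlueBPG ϑ aHi Λ θ s ν) (hglueS : SubWindowBudgetGlueBPG ϑ aHi Λ Λ' θ s s' ν ν')
    (hLD : LinearExcessDecayZ) (hRC : EquilChartStrainP s' Λ' ν') (h4 : TailFluxBSP aHi Λ' θ s')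
    (hU : UniformTameStabilityE s Λ ν) (hN : EnergyNearChartPX aHi Λ θ s ν) (hKS : KornSobolevPoincareP aHi θ) :
    CoherentGscCaccioppoliPsiBPG ϑ aHi Λ θ s :=
  coherentGscCaccioppoliPsiBPG_of_glues hs hΛ hglueC hglueS tailDominationCert_holds hLD harmonicComparisonZ_holds
    linearisationDefectP_holds hRC h4 hU hN hKS

/-- (HC) with its (T) antecedent discharged, in the shape the glue consumes it. [this file, g57] -/
theorem harmonicComparisonZ_apply {κ₀ : ℝ} (hκ₀ : 0 < κ₀) {c₀ : ℝ} (hc₀ : 0 < c₀) {C₁ : ℝ} (hC₁ : 0 < C₁) :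
    ∃ κ₁ : ℝ, 0 < κ₁ ∧ ∃ ϱ₁ : ℝ, 1 ≤ ϱ₁ ∧ ∀ ϱ : ℝ, ϱ₁ ≤ ϱ →
      ∀ (a b : E3) (w : ℤ → E3), IsLayeredCrystal c₀ a b w → IsTameIndexing C₁ a b w → CoerciveZ (layeredKernel a b w) κ₀ →
        ∀ P : Set (Cell 2 × ℤ), P.Finite → ∀ φ : Cell 2 → ℤ → E3, ∃ V : Cell 2 → ℤ → E3,
          (∀ X : Cell 2 × ℤ, X ∉ P → V X.1 X.2 = φ X.1 X.2) ∧ IsTruncHarmonicZ ϱ a b w V P ∧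
          κ₁ * idxEnergy (φ - V) {X | ∃ Y ∈ P, dist X Y ≤ 1} ≤
            |∑ᶠ X ∈ P, ⟪truncResidual ϱ a b w φ X, φ X.1 X.2 - V X.1 X.2⟫_ℝ| :=
  harmonicComparisonZ_holds tailDominationCert_holds κ₀ hκ₀ c₀ hc₀ C₁ hC₁

/-- Record example: the docket of record (`strainNonConcentrationBPG_1_50_of_docketPsi`, part UN) at column `_16XH19B`'s literals with [CC°_Ψᵇ] AND [SBᵇ]
unfolded into their glues and ONLY the open leaves as hypotheses: residuals [T_bᵇ], [W_Ψᵇ]; the two typed glues; (LD), (RC)(1/25, 3, 1/1000), (I4ˢ)(3, 1/25),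
hU, hN, [KS] — (T), (HC), (PT), (I1), (I0), (I5) are theorems. -/
example (hG : ZatorskaGoldstein2005_localGehringLemmaCounting)
    (hI : DressedCorePG tameRadius dressLevel dressLevel dressExponent 8 collarRadius clusterSize 1 2 (1 / 16) (1 / 50))
    (hTb : BareTameWindowBPG tameRadius dressLevel dressLevel dressExponent 8 collarRadius clusterSize 1 2 (1 / 16) (1 / 50))
    (hKS : KornSobolevPoincareP 1 (1 / 16)) (hW : CoherentWindowPsiBPG tameRadius 1 2 (1 / 16) (1 / 50))
    (hglueC : CaccioppoliGlueBPG tameRadius 1 2 (1 / 16) (1 / 50) (1 / 2000))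
    (hglueS : SubWindowBudgetGlueBPG tameRadius 1 2 3 (1 / 16) (1 / 50) (1 / 25) (1 / 2000) (1 / 1000))
    (hLD : LinearExcessDecayZ) (hRC : EquilChartStrainP (1 / 25) 3 (1 / 1000)) (h4 : TailFluxBSP 1 3 (1 / 16) (1 / 25))
    (hU : UniformTameStabilityE (1 / 50) 2 (1 / 2000)) (hN : EnergyNearChartPX 1 2 (1 / 16) (1 / 50) (1 / 2000)) :
    StrainNonConcentrationBPG 1 2 (1 / 16) (1 / 50) :=
  strainNonConcentrationBPG_1_50_of_docketPsi hG hI hTb hKS hW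
    (coherentGscCaccioppoliPsiBPG_of_open_pieces (by norm_num) (by norm_num) hglueC hglueS hLD hRC h4 hU hN hKS)

end Summit.AtomisticToContinuum.Crystallization.Theorems.ChartedZeroExcessLayeredLatticeLiouville

end
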